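import Literature.Geometry.Kaehler.ChartWindow
import Literature.Geometry.Kaehler.HolomorphicChainBlowUpChart
import Literature.Geometry.GeometricMeasureTheory.RectifiableImagePieceBasis

/-!
# The graph current of a chart window

For a chart window `W` (`ChartWindow.lean`: an orthogonally normalised holomorphic chart `Ψ` of a
complex subspace `K` of dimension `p`, centred at `m`) and `a < ρ`, the **graph current with
multiplicity `d`** over the disc of radius `a` is the `2p`-current of integration
`W.graphCurrent e d a = [Ψ(ball 0 a), d, GS(DΨ e)]` on `V` (`e = (b₀, I b₀, …)` the real frame of a
unitary basis of `K`, the complex orientation), built with the image data of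
`RectifiableImagePieceData.lean`. Main facts:

* `ChartWindow.isRectifiable_graphCurrent` — it is a rectifiable current with compact support
  (`isRectifiableData_image_density'`: `Ψ` is an anti-Lipschitz injective immersion on the ball);
  `ChartWindow.graphCurrent_apply` — `[Γ, d](φ) = d ∫_{ball 0 a} φ(Ψ k)(DΨ(k) e) dk`;
* `HolomorphicChain.currentOfIntegration_image_eq_graphData` — **a holomorphic chain read in an
  orthonormal chart is a graph current**: if `Ψ` is a chart of the chain `S` at a carrier point
  (tangent spaces `im DΨ`, density a.e. `d` near the point), then for every measurable
  `E ⊆ ball 0 a` with `Ψ(E)` inside the chart neighbourhood,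
  `[Ψ(E), θ_S, ξ_S] = [Ψ(E), d, GS(DΨ e)]` (the orientation of `[S]` is the complex orientation of
  the tangent plane, `HolomorphicChain.frameVector_orientationFrame_chart_eq`).

Definitions with bodies + theorems; no named facts.

## References

* H. Federer, *Geometric Measure Theory*, Springer 1969, 4.1.28, 4.3.18 [Federer1969].
* R. Harvey, *Holomorphic chains and their boundaries*, PSPUM XXX.1 (1977), §1.4, App. A [Harvey1977].
-/

noncomputable section

open scoped Manifold Topology ENNReal NNReal InnerProductSpace ContDiff
open Set Filter MeasureTheory Metric Function Module TopologicalSpace InnerProductSpace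

namespace Literature.Geometry.Kaehler

open Literature.Geometry.GeometricMeasureTheory Literature.Analysis.Calculus

-- Nested operator-norm instances on (duals of) `V [⋀^Fin n]→L[ℝ] ℝ`.
set_option maxSynthPendingDepth 2

universe u

variable {V : Type u} [NormedAddCommGroup V] [InnerProductSpace ℂ V] [FiniteDimensional ℂ V]

namespace ChartWindow

variable (W : ChartWindow V)

/-- The real differential `DΨ(k)` of the chart. [folklore] -/
def chartDeriv (k : W.K) : W.K →L[ℝ] V := (fderiv ℂ W.Ψ k).restrictScalars ℝ

/-- On the ball, `Ψ` has derivative `chartDeriv` within the ball. [folklore] -/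
theorem hasFDerivWithinAt_chart {s : Set W.K} (hs : s ⊆ ball (0 : W.K) W.ρ) {k : W.K} (hk : k ∈ s) :
    HasFDerivWithinAt W.Ψ (W.chartDeriv k) s k := by
  have hkρ := hs hk
  exact (((W.differentiableOn k hkρ).differentiableAt (isOpen_ball.mem_nhds hkρ)).hasFDerivAt.restrictScalars
    ℝ).hasFDerivWithinAt

/-- `DΨ(k)` is injective (`P_K ∘ DΨ(k) = id`). [folklore] -/
theorem injective_chartDeriv {k : W.K} (hk : k ∈ ball (0 : W.K) W.ρ) : Injective (W.chartDeriv k) :=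
  HolomorphicChain.injective_fderiv_chart W.differentiableOn W.proj_eq hk

/-- `Ψ` is `1`-anti-Lipschitz on the ball (`‖k − k'‖ ≤ ‖Ψ k − Ψ k'‖`). [folklore] -/
theorem antilipschitz_chart {s : Set W.K} (hs : s ⊆ ball (0 : W.K) W.ρ) :
    AntilipschitzWith 1 (s.restrict W.Ψ) := by
  refine AntilipschitzWith.of_le_mul_dist fun x y => ?_
  simp only [NNReal.coe_one, one_mul, Subtype.dist_eq, dist_eq_norm, restrict_apply]
  have h := OrthoChart.norm_sub_le_norm_sub (Ψ := W.Ψ) (y := W.m) le_rfl W.proj_eq (hs x.2) (hs y.2)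
  have h2 : ‖((x : W.K) : V) - ((y : W.K) : V)‖ = ‖(x : W.K) - y‖ := by
    rw [← Submodule.coe_sub, Submodule.coe_norm]
  calc ‖(x : W.K) - y‖ = ‖((x : W.K) : V) - ((y : W.K) : V)‖ := h2.symm
    _ = ‖(((x : W.K) - y : W.K) : V)‖ := by rw [Submodule.coe_sub]
    _ ≤ ‖W.Ψ x - W.Ψ y‖ := h

/-- `Ψ` is Lipschitz on `ball 0 a` (`a < ρ`) with the bound of its derivative there. [folklore] -/
theorem lipschitzOnWith_chart {a M : ℝ} (ha : a ≤ W.ρ) (hM : ∀ k ∈ ball (0 : W.K) W.ρ, ‖fderiv ℂ W.Ψ k‖ ≤ M) :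
    LipschitzOnWith (Real.toNNReal M) W.Ψ (ball (0 : W.K) a) := by
  have hdiff : ∀ k ∈ ball (0 : W.K) a, DifferentiableAt ℂ W.Ψ k := fun k hk =>
    (W.differentiableOn k (ball_subset_ball ha hk)).differentiableAt
      (isOpen_ball.mem_nhds (ball_subset_ball ha hk))
  refine (convex_ball (0 : W.K) a).lipschitzOnWith_of_nnnorm_fderiv_le (𝕜 := ℂ) hdiff fun k hk => ?_
  rw [← NNReal.coe_le_coe, coe_nnnorm]
  exact (hM k (ball_subset_ball ha hk)).trans (Real.le_coe_toNNReal M)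

section Current

variable [MeasurableSpace V] [BorelSpace V] {p : ℕ}

/-- **The graph current `[Ψ(ball 0 a), d, GS(DΨ e)]`** of the window, with multiplicity `d`, for
a real orthonormal basis `e` of `K`. [cite: Federer1969, 4.1.28, 4.3.18] -/
def graphCurrent (e : letI : InnerProductSpace ℝ W.K := InnerProductSpace.complexToReal
    OrthonormalBasis (Fin (2 * p)) ℝ W.K) (d : ℤ) (a : ℝ) : Current (⊤ : Opens V) (2 * p) :=
  letI : InnerProductSpace ℝ V := InnerProductSpace.complexToReal
  letI : InnerProductSpace ℝ W.K := InnerProductSpace.complexToReal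
  currentOfIntegration (W.Ψ '' ball (0 : W.K) a) (imageDensity W.Ψ (ball (0 : W.K) a) fun _ => d)
    (imageFrame W.Ψ W.chartDeriv (ball (0 : W.K) a) e)

/-- The constant density `d • (DΨ e₁ ∧ ⋯ ∧ DΨ e_{2p})` is integrable on the ball. [folklore] -/
theorem integrableOn_smul_frameVector_chartDeriv
    (e : letI : InnerProductSpace ℝ W.K := InnerProductSpace.complexToReal
      OrthonormalBasis (Fin (2 * p)) ℝ W.K)
    (d : ℤ) {a M : ℝ} (ha : a ≤ W.ρ) (hM : ∀ k ∈ ball (0 : W.K) W.ρ, ‖fderiv ℂ W.Ψ k‖ ≤ M) :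
    letI : InnerProductSpace ℝ V := InnerProductSpace.complexToReal
    letI : InnerProductSpace ℝ W.K := InnerProductSpace.complexToReal
    IntegrableOn (fun k => (d : ℝ) • frameVector fun j => W.chartDeriv k (e j)) (ball (0 : W.K) a) := by
  letI : InnerProductSpace ℝ V := InnerProductSpace.complexToReal
  letI : InnerProductSpace ℝ W.K := InnerProductSpace.complexToReal
  haveI : FiniteDimensional ℝ W.K := FiniteDimensional.complexToReal W.K
  haveI : ProperSpace W.K := FiniteDimensional.proper ℝ W.K
  refine integrableOn_smul_frameVector_comp measurableSet_ball
    (fun k hk => W.hasFDerivWithinAt_chart (ball_subset_ball ha) hk) e (C := M) (fun k hk => ?_)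
    measure_ball_lt_top.ne (d : ℝ)
  rw [chartDeriv, ContinuousLinearMap.norm_restrictScalars]
  exact hM k (ball_subset_ball ha hk)

/-- **The graph current has admissible rectifiable data.** [cite: Federer1969, 4.1.28] -/
theorem isRectifiableData_graphCurrent
    (e : letI : InnerProductSpace ℝ W.K := InnerProductSpace.complexToReal
      OrthonormalBasis (Fin (2 * p)) ℝ W.K)
    (d : ℤ) {a M : ℝ} (ha : a ≤ W.ρ) (hM : ∀ k ∈ ball (0 : W.K) W.ρ, ‖fderiv ℂ W.Ψ k‖ ≤ M) :
    letI : InnerProductSpace ℝ V := InnerProductSpace.complexToReal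
    letI : InnerProductSpace ℝ W.K := InnerProductSpace.complexToReal
    IsRectifiableData (⊤ : Opens V) (2 * p) (W.Ψ '' ball (0 : W.K) a)
      (imageDensity W.Ψ (ball (0 : W.K) a) fun _ => d)
      (imageFrame W.Ψ W.chartDeriv (ball (0 : W.K) a) e) := by
  letI : InnerProductSpace ℝ V := InnerProductSpace.complexToReal
  letI : InnerProductSpace ℝ W.K := InnerProductSpace.complexToReal
  haveI : FiniteDimensional ℝ W.K := FiniteDimensional.complexToReal W.K
  exact isRectifiableData_image_density' e measurableSet_ball
    (fun k hk => W.hasFDerivWithinAt_chart (ball_subset_ball ha) hk)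
    (fun k hk => W.injective_chartDeriv (ball_subset_ball ha hk))
    (W.antilipschitz_chart (ball_subset_ball ha)) (W.lipschitzOnWith_chart ha hM)
    (W.integrableOn_smul_frameVector_chartDeriv e d ha hM) (subset_univ _)

omit [MeasurableSpace V] [BorelSpace V] in
/-- `Ψ(closedBall 0 a)` is compact for `a < ρ`. [folklore] -/
theorem isCompact_image_closedBall {a : ℝ} (ha : a < W.ρ) : IsCompact (W.Ψ '' closedBall (0 : W.K) a) := by
  haveI : FiniteDimensional ℝ W.K := FiniteDimensional.complexToReal W.K
  haveI : ProperSpace W.K := FiniteDimensional.proper ℝ W.K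
  refine (isCompact_closedBall (0 : W.K) a).image_of_continuousOn ?_
  exact W.differentiableOn.continuousOn.mono (closedBall_subset_ball ha)

/-- **The graph current is rectifiable** (compact support in `Ψ(closedBall 0 a)`).
[cite: Federer1969, 4.1.24, 4.1.28] -/
theorem isRectifiable_graphCurrent
    (e : letI : InnerProductSpace ℝ W.K := InnerProductSpace.complexToReal
      OrthonormalBasis (Fin (2 * p)) ℝ W.K)
    (d : ℤ) {a M : ℝ} (ha : a < W.ρ) (hM : ∀ k ∈ ball (0 : W.K) W.ρ, ‖fderiv ℂ W.Ψ k‖ ≤ M) :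
    letI : InnerProductSpace ℝ V := InnerProductSpace.complexToReal
    (W.graphCurrent e d a).IsRectifiable := by
  letI : InnerProductSpace ℝ V := InnerProductSpace.complexToReal
  refine ⟨⟨_, _, _, W.isRectifiableData_graphCurrent e d ha.le hM, rfl⟩, ?_⟩
  refine Current.isCompact_support_of_subset _ (W.isCompact_image_closedBall ha) (subset_univ _) ?_
  refine (support_currentOfIntegration_subset_closure _ _ _).trans ?_
  exact closure_minimal (image_mono ball_subset_closedBall) (W.isCompact_image_closedBall ha).isClosed

/-- The support of the graph current lies in `Ψ(closedBall 0 a)`. [folklore] -/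
theorem support_graphCurrent_subset (e : letI : InnerProductSpace ℝ W.K := InnerProductSpace.complexToReal
      OrthonormalBasis (Fin (2 * p)) ℝ W.K) (d : ℤ) {a : ℝ} (ha : a < W.ρ) :
    (W.graphCurrent e d a).support ⊆ W.Ψ '' closedBall (0 : W.K) a :=
  (support_currentOfIntegration_subset_closure _ _ _).trans
    (closure_minimal (image_mono ball_subset_closedBall) (W.isCompact_image_closedBall ha).isClosed)

/-- **The graph current as a parameter integral**: `[Γ, d](φ) = d ∫_{ball 0 a} φ(Ψ k)(DΨ(k) e) dk`.
[cite: Federer1969, 4.1.25, 3.2.5] -/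
theorem graphCurrent_apply
    (e : letI : InnerProductSpace ℝ W.K := InnerProductSpace.complexToReal
      OrthonormalBasis (Fin (2 * p)) ℝ W.K)
    (d : ℤ) {a M : ℝ} (ha : a ≤ W.ρ) (hM : ∀ k ∈ ball (0 : W.K) W.ρ, ‖fderiv ℂ W.Ψ k‖ ≤ M)
    (φ : TestForm (⊤ : Opens V) (2 * p)) :
    letI : InnerProductSpace ℝ W.K := InnerProductSpace.complexToReal
    W.graphCurrent e d a φ = (d : ℝ) * ∫ k in ball (0 : W.K) a, φ (W.Ψ k) fun j => W.chartDeriv k (e j) := by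
  letI : InnerProductSpace ℝ V := InnerProductSpace.complexToReal
  letI : InnerProductSpace ℝ W.K := InnerProductSpace.complexToReal
  haveI : FiniteDimensional ℝ W.K := FiniteDimensional.complexToReal W.K
  have hinj : InjOn W.Ψ (ball (0 : W.K) a) := fun x hx y hy h => by
    have := (W.antilipschitz_chart (ball_subset_ball ha)).injective (a₁ := ⟨x, hx⟩) (a₂ := ⟨y, hy⟩)
      (by simpa using h)
    exact congrArg Subtype.val this
  rw [graphCurrent, currentOfIntegration_image_density_apply measurableSet_ball
    (fun k hk => W.hasFDerivWithinAt_chart (ball_subset_ball ha) hk)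
    (fun k hk => W.injective_chartDeriv (ball_subset_ball ha hk)) hinj e
    (W.integrableOn_smul_frameVector_chartDeriv e d ha hM), ← integral_const_mul]

end Current

end ChartWindow

/-! ### A holomorphic chain read in an orthonormal chart is a graph current -/

namespace HolomorphicChain

variable [MeasurableSpace V] [BorelSpace V] {Ω : Opens V} {p : ℕ}

/-- **`[Ψ(E), θ_S, ξ_S] = [Ψ(E), d, GS(DΨ e)]`**: in an orthonormally normalised chart `Ψ` of the
chain `S` (graph over `K` w.r.t. `P_K`, tangent spaces `im DΨ`, density a.e. `d` on `reg|S| ∩ N`),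
every piece `Ψ(E)`, `E ⊆ ball 0 a` measurable with `Ψ(E) ⊆ N`, of the current of `S` is the graph
current with multiplicity `d` and the complex orientation. [cite: Federer1969, 4.1.28, 4.3.18; Harvey1977, App. A.2] -/
theorem currentOfIntegration_image_eq_graphData (S : HolomorphicChain 𝓘(ℂ, V) Ω p)
    (W : ChartWindow V) (hKp : finrank ℂ W.K = p) (bK : OrthonormalBasis (Fin p) ℂ W.K)
    {N : Set V} (hcar : ∀ k ∈ ball (0 : W.K) W.ρ, W.Ψ k ∈ S.carrier)
    (htan : ∀ k ∈ ball (0 : W.K) W.ρ,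
      approxTangentCone (2 * p) ((μHE[2 * p] : Measure V).restrict S.carrier) (W.Ψ k) =
        Set.range (fderiv ℂ W.Ψ k))
    {d : ℤ} (hdens : ∀ᵐ y ∂((μHE[2 * p] : Measure V).restrict (S.carrier ∩ N)), S.density y = d)
    {a : ℝ} (ha : a ≤ W.ρ) {E : Set W.K} (hEm : MeasurableSet E) (hEa : E ⊆ ball (0 : W.K) a)
    (hEN : W.Ψ '' E ⊆ N) {Ω' : Opens V} :
    letI : InnerProductSpace ℝ V := InnerProductSpace.complexToReal
    letI : InnerProductSpace ℝ W.K := InnerProductSpace.complexToReal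
    ∀ e : OrthonormalBasis (Fin (2 * p)) ℝ W.K, ⇑e = complexFrame ⇑bK →
      (currentOfIntegration (W.Ψ '' E) S.density S.orientationFrame : Current Ω' (2 * p)) =
        currentOfIntegration (W.Ψ '' E) (imageDensity W.Ψ E fun _ => d)
          (imageFrame W.Ψ W.chartDeriv E e) := by
  letI : InnerProductSpace ℝ V := InnerProductSpace.complexToReal
  letI : InnerProductSpace ℝ W.K := InnerProductSpace.complexToReal
  intro e he
  have hEρ : E ⊆ ball (0 : W.K) W.ρ := hEa.trans (ball_subset_ball ha)
  have hinj : InjOn W.Ψ E := fun x hx y hy h => by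
    have := (W.antilipschitz_chart hEρ).injective (a₁ := ⟨x, hx⟩) (a₂ := ⟨y, hy⟩) (by simpa using h)
    exact congrArg Subtype.val this
  have hWm : MeasurableSet (W.Ψ '' E) :=
    measurableSet_image_of_hasFDerivWithinAt hEm (fun k hk => W.hasFDerivWithinAt_chart hEρ hk) hinj
  -- the two density fields agree a.e. on `Ψ(E)`
  rw [currentOfIntegration_eq_vectorCurrent_indicator hWm,
    currentOfIntegration_eq_vectorCurrent_indicator hWm]
  refine vectorCurrent_congr_ae ?_
  have hsub : W.Ψ '' E ⊆ S.carrier ∩ N := fun y hy => by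
    obtain ⟨k, hk, rfl⟩ := hy
    exact ⟨hcar k (hEρ hk), hEN ⟨k, hk, rfl⟩⟩
  have hd : ∀ᵐ y ∂((μHE[2 * p] : Measure V).restrict (W.Ψ '' E)), S.density y = d :=
    ae_mono (Measure.restrict_mono hsub le_rfl) hdens
  filter_upwards [(ae_restrict_iff' hWm).1 hd] with y hy
  by_cases hymem : y ∈ W.Ψ '' E
  · obtain ⟨k, hk, rfl⟩ := hymem
    have hmem' : W.Ψ k ∈ W.Ψ '' E := ⟨k, hk, rfl⟩
    rw [indicator_of_mem hmem', indicator_of_mem hmem', hy hmem', imageDensity_apply_image hinj _ hk,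
      imageFrame_apply_image hinj e hk]
    congr 1
    exact S.frameVector_orientationFrame_chart_eq hKp W.differentiableOn W.proj_eq htan bK (hEρ hk) e he
  · rw [indicator_of_notMem hymem, indicator_of_notMem hymem]

end HolomorphicChain

end Literature.Geometry.Kaehler
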